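import Summits.AnomalousDissipation.AnomalousDissipation.Theorems.WazewskiBlockDefs

/-!
# Route `WazewskiBlock`, item stmt-AnomalousDissipation-10354 — the oblique class, I: coordinates

Analysis of the objects of `WazewskiBlockDefs` (the oblique symmetry class of 3-D Kolmogorov flow
in the Galerkin phase space `galerkinSubspace (freqBall N)`):

* the polarisation basis `basisVec k σ` is orthonormal and transversal at lattice modes;
* `Ψ ∘ Φ = id` (`obliqueCoord_obliqueCoeff`);
* `Φ x` is a real, transversal coefficient vector (`obliqueCoeff_mem`), the Kolmogorov force
  coefficients are real (`isRealCoeff_kolmogorovCoeff`);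
* bookkeeping for the forcing wave vector `e = (0,2,0)` and the laminar coefficients
  `û(±e) = ∓(iA/2)e₀` (`obliqueCoeff_laminarCoord`).

All statements proved; no definitions.
-/

noncomputable section

-- `Summit.<Summit>.<Problem>` is the tree's mandated summit-side namespace (CONVENTIONS §2); deliberate duplicate.
set_option linter.dupNamespace false

open scoped InnerProductSpace ComplexConjugate
open Finset
open Literature.Analysis.FunctionSpaces Literature.Analysis.FunctionSpaces.Torus
open Literature.Analysis.FluidPDE Literature.Analysis.FluidPDE.Torus

namespace Summit.AnomalousDissipation.AnomalousDissipation.Theorems.Oblique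
/-! ### Sanity: geometry of the polarisation vectors -/

/-- On the oblique lattice `|k|² = 2k₀² + k₁²`. [folklore] -/
theorem freqNormSq_eq_of_mem {N : ℕ} {k : Fin 3 → ℤ} (hk : k ∈ obliqueModes N) :
    freqNormSq k = 2 * (k 0 : ℝ) ^ 2 + (k 1 : ℝ) ^ 2 := by
  obtain ⟨_, _, h02, _⟩ := mem_obliqueModes.1 hk
  simp only [freqNormSq, Fin.sum_univ_three, ← h02]
  ring

/-- Lattice modes have positive `|k|²`. [folklore] -/
theorem freqNormSq_pos_of_mem {N : ℕ} {k : Fin 3 → ℤ} (hk : k ∈ obliqueModes N) : 0 < freqNormSq k := by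
  obtain ⟨_, h0, _, _⟩ := mem_obliqueModes.1 hk
  rcases (freqNormSq_nonneg k).lt_or_eq with h | h
  · exact h
  · exact absurd ((Literature.Analysis.FluidPDE.Torus.freqNormSq_eq_zero_iff k).1 h.symm) h0

/-- `perpVec` is a unit vector. [folklore] -/
theorem inner_perpVec_perpVec : ⟪perpVec, perpVec⟫_ℝ = 1 := by
  have h2 : Real.sqrt 2 ^ 2 = 2 := Real.sq_sqrt (by norm_num)
  have hs : Real.sqrt 2 ≠ 0 := by positivity
  simp only [PiLp.inner_apply, RCLike.inner_apply, conj_trivial, Fin.sum_univ_three, perpVec_apply_zero,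
    perpVec_apply_one, perpVec_apply_two]
  field_simp
  nlinarith [h2]

/-- `inVec k` is a unit vector for lattice modes `k`. [folklore] -/
theorem inner_inVec_inVec {N : ℕ} {k : Fin 3 → ℤ} (hk : k ∈ obliqueModes N) : ⟪inVec k, inVec k⟫_ℝ = 1 := by
  have hq := freqNormSq_eq_of_mem hk
  have hpos := freqNormSq_pos_of_mem hk
  have h2 : Real.sqrt 2 ^ 2 = 2 := Real.sq_sqrt (by norm_num)
  have hs : Real.sqrt (freqNormSq k) ^ 2 = freqNormSq k := Real.sq_sqrt hpos.le
  have hne1 : Real.sqrt 2 ≠ 0 := by positivity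
  have hne2 : Real.sqrt (freqNormSq k) ≠ 0 := by positivity
  simp only [PiLp.inner_apply, RCLike.inner_apply, conj_trivial, Fin.sum_univ_three, inVec_apply_zero,
    inVec_apply_one, inVec_apply_two]
  field_simp
  rw [h2, hs, hq]
  ring

/-- `inVec k ⊥ perpVec`. [folklore] -/
theorem inner_inVec_perpVec (k : Fin 3 → ℤ) : ⟪inVec k, perpVec⟫_ℝ = 0 := by
  simp only [PiLp.inner_apply, RCLike.inner_apply, conj_trivial, Fin.sum_univ_three, inVec_apply_zero,
    inVec_apply_one, inVec_apply_two, perpVec_apply_zero, perpVec_apply_one, perpVec_apply_two]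
  ring

/-- The polarisation basis is orthonormal at lattice modes. [folklore] -/
theorem inner_basisVec {N : ℕ} {k : Fin 3 → ℤ} (hk : k ∈ obliqueModes N) (σ σ' : Fin 2) :
    ⟪basisVec k σ, basisVec k σ'⟫_ℝ = if σ = σ' then 1 else 0 := by
  fin_cases σ <;> fin_cases σ'
  · simpa [basisVec] using inner_inVec_inVec hk
  · simpa [basisVec] using inner_inVec_perpVec k
  · simp only [basisVec]
    rw [real_inner_comm]
    simpa using inner_inVec_perpVec k
  · simpa [basisVec] using inner_perpVec_perpVec

/-- `perpVec` is transversal to lattice modes (`k₀ = k₂`). [folklore] -/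
theorem sum_mul_perpVec {N : ℕ} {k : Fin 3 → ℤ} (hk : k ∈ obliqueModes N) : ∑ j, (k j : ℝ) * perpVec j = 0 := by
  obtain ⟨_, _, h02, _⟩ := mem_obliqueModes.1 hk
  simp only [Fin.sum_univ_three, perpVec_apply_zero, perpVec_apply_one, perpVec_apply_two, ← h02]
  ring

/-- `inVec k` is transversal to `k` (for `k₀ = k₂`). [folklore] -/
theorem sum_mul_inVec {N : ℕ} {k : Fin 3 → ℤ} (hk : k ∈ obliqueModes N) : ∑ j, (k j : ℝ) * inVec k j = 0 := by
  obtain ⟨_, _, h02, _⟩ := mem_obliqueModes.1 hk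
  simp only [Fin.sum_univ_three, inVec_apply_zero, inVec_apply_one, inVec_apply_two, ← h02]
  ring

/-- The polarisation vectors are transversal. [folklore] -/
theorem sum_mul_basisVec {N : ℕ} {k : Fin 3 → ℤ} (hk : k ∈ obliqueModes N) (σ : Fin 2) :
    ∑ j, (k j : ℝ) * basisVec k σ j = 0 := by
  fin_cases σ
  · simpa [basisVec] using sum_mul_inVec hk
  · simpa [basisVec] using sum_mul_perpVec hk

/-! ### `Ψ ∘ Φ = id` -/

/-- The coefficient vector on a representative. [folklore] -/
theorem obliqueCoeff_apply_of_mem {N : ℕ} (x : ObliqueIndex N → ℝ) {k : ↥(freqBall (d := Fin 3) N)}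
    (hk : (k : Fin 3 → ℤ) ∈ obliqueReps N) :
    obliqueCoeff N x k =
      Complex.I • EuclideanSpace.complexify (∑ σ : Fin 2, x (⟨(k : Fin 3 → ℤ), hk⟩, σ) • basisVec k σ) := by
  simp [obliqueCoeff, hk]

/-- The coefficient vector on the negative of a representative. [folklore] -/
theorem obliqueCoeff_apply_of_neg_mem {N : ℕ} (x : ObliqueIndex N → ℝ) {k : ↥(freqBall (d := Fin 3) N)}
    (hk : -(k : Fin 3 → ℤ) ∈ obliqueReps N) :
    obliqueCoeff N x k =
      -(Complex.I • EuclideanSpace.complexify (∑ σ : Fin 2, x (⟨-(k : Fin 3 → ℤ), hk⟩, σ) • basisVec (-k) σ)) := by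
  have hk' : (k : Fin 3 → ℤ) ∉ obliqueReps N := fun h => not_neg_mem_obliqueReps h hk
  simp [obliqueCoeff, hk, hk']

/-- The coefficient vector off the lattice. [folklore] -/
theorem obliqueCoeff_apply_of_not_mem {N : ℕ} (x : ObliqueIndex N → ℝ) {k : ↥(freqBall (d := Fin 3) N)}
    (hk : (k : Fin 3 → ℤ) ∉ obliqueModes N) : obliqueCoeff N x k = 0 := by
  have h1 : (k : Fin 3 → ℤ) ∉ obliqueReps N := fun h => hk (obliqueReps_subset N h)
  have h2 : -(k : Fin 3 → ℤ) ∉ obliqueReps N := fun h => hk (by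
    simpa using neg_mem_obliqueModes (obliqueReps_subset N h))
  simp [obliqueCoeff, h1, h2]

/-- **`Ψ ∘ Φ = id`**: the oblique coordinates of the coefficient vector with coordinates `x` are `x`
(orthonormality of the polarisation basis). [folklore] -/
theorem obliqueCoord_obliqueCoeff {N : ℕ} (x : ObliqueIndex N → ℝ) :
    obliqueCoord N (obliqueCoeff N x) = x := by
  funext p
  obtain ⟨⟨k, hk⟩, σ⟩ := p
  have hkm : k ∈ obliqueModes N := obliqueReps_subset N hk
  simp only [obliqueCoord]
  rw [obliqueCoeff_apply_of_mem x (k := ⟨k, mem_freqBall_of_mem_obliqueReps hk⟩) hk]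
  have hcomp : ∀ j : Fin 3, ((Complex.I • EuclideanSpace.complexify
      (∑ σ' : Fin 2, x (⟨k, hk⟩, σ') • basisVec k σ')) j).im =
      (∑ σ' : Fin 2, x (⟨k, hk⟩, σ') • basisVec k σ') j := fun j => by
    simp [EuclideanSpace.complexify_apply]
  simp_rw [hcomp]
  have hinner : ∀ σ' : Fin 2, ∑ j : Fin 3, basisVec k σ j * basisVec k σ' j = ⟪basisVec k σ, basisVec k σ'⟫_ℝ :=
    fun σ' => by
      simp only [PiLp.inner_apply, RCLike.inner_apply, conj_trivial]
      exact Finset.sum_congr rfl fun j _ => mul_comm _ _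
  calc ∑ j : Fin 3, basisVec k σ j * (∑ σ' : Fin 2, x (⟨k, hk⟩, σ') • basisVec k σ') j
      = ∑ σ' : Fin 2, x (⟨k, hk⟩, σ') * ∑ j : Fin 3, basisVec k σ j * basisVec k σ' j := by
        simp only [WithLp.ofLp_sum, WithLp.ofLp_smul, Finset.sum_apply, Pi.smul_apply, smul_eq_mul,
          Finset.mul_sum]
        rw [Finset.sum_comm]
        refine Finset.sum_congr rfl fun σ' _ => Finset.sum_congr rfl fun j _ => by ring
    _ = x (⟨k, hk⟩, σ) := by
        simp_rw [hinner, inner_basisVec hkm]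
        simp [Finset.sum_ite_eq]

/-! ### `Φ x` lies in the Galerkin phase space; the force is real -/

/-- Conjugation of `i • complexify r` is `-(i • complexify r)`. [folklore] -/
theorem conjVec_I_smul_complexify (r : EuclideanSpace ℝ (Fin 3)) :
    EuclideanSpace.conjVec (Complex.I • EuclideanSpace.complexify r) =
      -(Complex.I • EuclideanSpace.complexify r) := by
  rw [EuclideanSpace.conjVec_smul, EuclideanSpace.conjVec_complexify, Complex.conj_I, neg_smul]

/-- **`Φ x` is a real (conjugate-symmetric) coefficient vector.** [folklore] -/
theorem isRealCoeff_obliqueCoeff {N : ℕ} (x : ObliqueIndex N → ℝ) : IsRealCoeff (obliqueCoeff N x) := by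
  intro k l hlk
  by_cases hk : (k : Fin 3 → ℤ) ∈ obliqueReps N
  · have hl : -(l : Fin 3 → ℤ) ∈ obliqueReps N := by rw [hlk, neg_neg]; exact hk
    rw [obliqueCoeff_apply_of_mem x hk, obliqueCoeff_apply_of_neg_mem x hl, conjVec_I_smul_complexify]
    congr 2
    simp only [hlk, neg_neg]
  · by_cases hk' : -(k : Fin 3 → ℤ) ∈ obliqueReps N
    · have hl : (l : Fin 3 → ℤ) ∈ obliqueReps N := by rw [hlk]; exact hk'
      rw [obliqueCoeff_apply_of_neg_mem x hk', obliqueCoeff_apply_of_mem x hl, EuclideanSpace.conjVec_neg,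
        conjVec_I_smul_complexify, neg_neg]
      congr 2
      refine Finset.sum_congr rfl fun σ _ => ?_
      rw [show (⟨(l : Fin 3 → ℤ), hl⟩ : ↥(obliqueReps N)) = ⟨-(k : Fin 3 → ℤ), hk'⟩ from Subtype.ext hlk, hlk]
    · have hkm : (k : Fin 3 → ℤ) ∉ obliqueModes N := fun h =>
        (mem_obliqueReps_or_neg_mem h).elim hk hk'
      have hlm : (l : Fin 3 → ℤ) ∉ obliqueModes N := fun h => hkm (by
        have := neg_mem_obliqueModes h; rwa [hlk, neg_neg] at this)
      rw [obliqueCoeff_apply_of_not_mem x hkm, obliqueCoeff_apply_of_not_mem x hlm,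
        EuclideanSpace.conjVec_zero]

/-- **`Φ x` is transversal (divergence free).** [folklore] -/
theorem isSolenoidalCoeff_obliqueCoeff {N : ℕ} (x : ObliqueIndex N → ℝ) :
    IsSolenoidalCoeff (obliqueCoeff N x) := by
  intro k
  have key : ∀ (k' : Fin 3 → ℤ), k' ∈ obliqueModes N → ∀ (y : Fin 2 → ℝ),
      ∑ j, ((k' j : ℤ) : ℂ) * (Complex.I • EuclideanSpace.complexify (∑ σ : Fin 2, y σ • basisVec k' σ)) j = 0 := by
    intro k' hk' y
    have hreal : ∀ σ : Fin 2, ∑ j, (k' j : ℝ) * basisVec k' σ j = 0 := fun σ => sum_mul_basisVec hk' σ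
    have h1 : ∑ j, ((k' j : ℤ) : ℂ) * (Complex.I • EuclideanSpace.complexify (∑ σ : Fin 2, y σ • basisVec k' σ)) j =
        Complex.I * ∑ σ : Fin 2, (y σ : ℂ) * ∑ j, ((k' j : ℝ) : ℂ) * (basisVec k' σ j : ℂ) := by
      simp only [PiLp.smul_apply, EuclideanSpace.complexify_apply, WithLp.ofLp_sum, WithLp.ofLp_smul,
        Finset.sum_apply, Pi.smul_apply, smul_eq_mul, Complex.ofReal_sum, Complex.ofReal_mul,
        Finset.mul_sum]
      rw [Finset.sum_comm]
      refine Finset.sum_congr rfl fun σ _ => Finset.sum_congr rfl fun j _ => ?_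
      push_cast
      ring
    rw [h1]
    have h2 : ∀ σ : Fin 2, ∑ j, ((k' j : ℝ) : ℂ) * (basisVec k' σ j : ℂ) = 0 := fun σ => by
      have := congrArg (fun t : ℝ => (t : ℂ)) (hreal σ)
      simpa only [Complex.ofReal_sum, Complex.ofReal_mul, Complex.ofReal_zero] using this
    have h3 : ∑ σ : Fin 2, (y σ : ℂ) * ∑ j, ((k' j : ℝ) : ℂ) * (basisVec k' σ j : ℂ) = 0 :=
      Finset.sum_eq_zero fun σ _ => by rw [h2 σ, mul_zero]
    rw [h3, mul_zero]
  by_cases hk : (k : Fin 3 → ℤ) ∈ obliqueReps N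
  · rw [obliqueCoeff_apply_of_mem x hk]
    exact key _ (obliqueReps_subset N hk) _
  · by_cases hk' : -(k : Fin 3 → ℤ) ∈ obliqueReps N
    · rw [obliqueCoeff_apply_of_neg_mem x hk']
      have h := key (-(k : Fin 3 → ℤ)) (obliqueReps_subset N hk') fun σ => x (⟨-(k : Fin 3 → ℤ), hk'⟩, σ)
      simp only [Pi.neg_apply, Int.cast_neg, neg_mul, Finset.sum_neg_distrib, neg_eq_zero] at h
      simp only [PiLp.neg_apply, mul_neg, Finset.sum_neg_distrib, neg_eq_zero]
      exact h
    · have hkm : (k : Fin 3 → ℤ) ∉ obliqueModes N := fun h => (mem_obliqueReps_or_neg_mem h).elim hk hk'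
      simp [obliqueCoeff_apply_of_not_mem x hkm]

/-- `Φ x` belongs to the Galerkin phase space `galerkinSubspace (freqBall N)`. [folklore] -/
theorem obliqueCoeff_mem {N : ℕ} (x : ObliqueIndex N → ℝ) :
    obliqueCoeff N x ∈ galerkinSubspace (freqBall (d := Fin 3) N) :=
  ⟨isRealCoeff_obliqueCoeff x, isSolenoidalCoeff_obliqueCoeff x⟩

/-- `e ≠ -e` and `e ≠ 0` for the forcing wave vector. [folklore] -/
theorem modeE_ne_neg : modeE ≠ -modeE := by
  intro h
  have := congrFun h 1
  simp [modeE] at this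

/-- **The Kolmogorov force coefficients are real (conjugate symmetric).** [folklore] -/
theorem isRealCoeff_kolmogorovCoeff (F : ℝ) (N : ℕ) : IsRealCoeff (kolmogorovCoeff F N) := by
  intro k l hlk
  have hsmul : ∀ (a : ℝ),
      EuclideanSpace.conjVec (((a : ℝ) : ℂ) • Complex.I •
        EuclideanSpace.complexify (EuclideanSpace.single (0 : Fin 3) (1 : ℝ))) =
      -(((a : ℝ) : ℂ) • Complex.I • EuclideanSpace.complexify (EuclideanSpace.single (0 : Fin 3) (1 : ℝ))) :=
    fun a => by
      rw [EuclideanSpace.conjVec_smul, Complex.conj_ofReal, conjVec_I_smul_complexify, smul_neg]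
  simp only [kolmogorovCoeff]
  by_cases h1 : (k : Fin 3 → ℤ) = modeE
  · have hl : (l : Fin 3 → ℤ) = -modeE := by rw [hlk, h1]
    have hl' : (l : Fin 3 → ℤ) ≠ modeE := by rw [hl]; exact fun h => modeE_ne_neg h.symm
    rw [if_pos h1, if_neg hl', if_pos hl, EuclideanSpace.conjVec_neg, hsmul, neg_neg]
  · by_cases h2 : (k : Fin 3 → ℤ) = -modeE
    · have hl : (l : Fin 3 → ℤ) = modeE := by rw [hlk, h2, neg_neg]
      rw [if_neg h1, if_pos h2, if_pos hl, hsmul]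
    · have hl1 : (l : Fin 3 → ℤ) ≠ modeE := fun h => h2 (by rw [← neg_neg (k : Fin 3 → ℤ), ← hlk, h])
      have hl2 : (l : Fin 3 → ℤ) ≠ -modeE := fun h => h1 (by
        have : (k : Fin 3 → ℤ) = -(l : Fin 3 → ℤ) := by rw [hlk, neg_neg]
        rw [this, h, neg_neg])
      rw [if_neg h1, if_neg h2, if_neg hl1, if_neg hl2, EuclideanSpace.conjVec_zero]

/-! ### The forcing wave vector -/

/-- Coordinates of `e = (0,2,0)`. [folklore] -/
theorem modeE_apply_zero : modeE 0 = 0 := by simp [modeE]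

/-- Coordinates of `e = (0,2,0)`. [folklore] -/
theorem modeE_apply_one : modeE 1 = 2 := by simp [modeE]

/-- Coordinates of `e = (0,2,0)`. [folklore] -/
theorem modeE_apply_two : modeE 2 = 0 := by simp [modeE]

/-- `|e|² = 4`. [folklore] -/
theorem freqNormSq_modeE : freqNormSq modeE = 4 := by
  simp only [freqNormSq, Fin.sum_univ_three, modeE_apply_zero, modeE_apply_one, modeE_apply_two]
  norm_num

/-- `e ≠ 0`. [folklore] -/
theorem modeE_ne_zero : modeE ≠ 0 := by
  intro h; have := congrFun h 1; simp [modeE] at this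

/-- `e` is a representative lattice mode as soon as `N ≥ 2`. [folklore] -/
theorem modeE_mem_obliqueReps {N : ℕ} (hN : 2 ≤ N) : modeE ∈ obliqueReps N := by
  refine mem_obliqueReps.2 ⟨mem_obliqueModes.2 ⟨?_, modeE_ne_zero, ?_, ?_⟩, Or.inr ⟨modeE_apply_zero, ?_⟩⟩
  · rw [mem_freqBall, freqNormSq_modeE]
    have : (2 : ℝ) ≤ N := by exact_mod_cast hN
    nlinarith
  · rw [modeE_apply_zero, modeE_apply_two]
  · rw [modeE_apply_one]; exact even_two
  · rw [modeE_apply_one]; norm_num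

/-- `e` lies in the frequency ball for `N ≥ 2`. [folklore] -/
theorem modeE_mem_freqBall {N : ℕ} (hN : 2 ≤ N) : modeE ∈ freqBall (d := Fin 3) N :=
  mem_freqBall_of_mem_obliqueReps (modeE_mem_obliqueReps hN)

/-- `-e` lies in the frequency ball for `N ≥ 2`. [folklore] -/
theorem neg_modeE_mem_freqBall {N : ℕ} (hN : 2 ≤ N) : -modeE ∈ freqBall (d := Fin 3) N :=
  neg_mem_freqBall.2 (modeE_mem_freqBall hN)

/-- `inVec e = (1,0,1)/√2` and `perpVec = (-1,0,1)/√2` combine the laminar coordinates to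
`-(A/2) e₀`. [folklore] -/
theorem sum_laminarCoord_smul_basisVec {N : ℕ} (ν F : ℝ) (hN : 2 ≤ N) :
    ∑ σ : Fin 2, laminarCoord ν F N (⟨modeE, modeE_mem_obliqueReps hN⟩, σ) • basisVec modeE σ =
      (-(F / (16 * Real.pi ^ 2 * ν) / 2)) • EuclideanSpace.single (0 : Fin 3) (1 : ℝ) := by
  have hs4 : Real.sqrt (freqNormSq modeE) = 2 := by
    rw [freqNormSq_modeE, show (4 : ℝ) = 2 ^ 2 by norm_num, Real.sqrt_sq (by norm_num)]
  have hs2 : Real.sqrt 2 ≠ 0 := by positivity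
  have h2sq : Real.sqrt 2 ^ 2 = 2 := Real.sq_sqrt (by norm_num)
  rw [Fin.sum_univ_two]
  simp only [laminarCoord, basisVec, if_true, Fin.isValue, one_ne_zero, if_false]
  ext j
  fin_cases j
  · simp [inVec_apply_zero, perpVec_apply_zero, hs4, modeE_apply_one]
    field_simp
    rw [h2sq]
    ring
  · simp [inVec_apply_one, perpVec_apply_one, modeE_apply_zero]
  · simp [inVec_apply_two, perpVec_apply_two, hs4, modeE_apply_one]
    field_simp
    ring

/-- **The coefficient vector of the laminar state**: `û(±e) = ∓(iA/2) e₀`, `A = F/(16π²ν)`, zero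
elsewhere. [folklore] -/
theorem obliqueCoeff_laminarCoord {N : ℕ} (ν F : ℝ) (hN : 2 ≤ N) (k : ↥(freqBall (d := Fin 3) N)) :
    obliqueCoeff N (laminarCoord ν F N) k =
      if (k : Fin 3 → ℤ) = modeE then
        (-(F / (16 * Real.pi ^ 2 * ν) / 2) : ℝ) •
          (Complex.I • EuclideanSpace.complexify (EuclideanSpace.single (0 : Fin 3) (1 : ℝ)))
      else if (k : Fin 3 → ℤ) = -modeE then
        ((F / (16 * Real.pi ^ 2 * ν) / 2) : ℝ) •
          (Complex.I • EuclideanSpace.complexify (EuclideanSpace.single (0 : Fin 3) (1 : ℝ)))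
      else 0 := by
  have he := modeE_mem_obliqueReps hN
  by_cases h1 : (k : Fin 3 → ℤ) = modeE
  · rw [if_pos h1]
    have hk : (k : Fin 3 → ℤ) ∈ obliqueReps N := h1 ▸ he
    rw [obliqueCoeff_apply_of_mem _ hk]
    have : (∑ σ : Fin 2, laminarCoord ν F N (⟨(k : Fin 3 → ℤ), hk⟩, σ) • basisVec (k : Fin 3 → ℤ) σ) =
        (-(F / (16 * Real.pi ^ 2 * ν) / 2)) • EuclideanSpace.single (0 : Fin 3) (1 : ℝ) := by
      have hsub : (⟨(k : Fin 3 → ℤ), hk⟩ : ↥(obliqueReps N)) = ⟨modeE, he⟩ := Subtype.ext h1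
      rw [hsub, h1]
      exact sum_laminarCoord_smul_basisVec ν F hN
    rw [this, LinearIsometry.map_smul, smul_comm]
  · rw [if_neg h1]
    by_cases h2 : (k : Fin 3 → ℤ) = -modeE
    · rw [if_pos h2]
      have hk : -(k : Fin 3 → ℤ) ∈ obliqueReps N := by rw [h2, neg_neg]; exact he
      rw [obliqueCoeff_apply_of_neg_mem _ hk]
      have : (∑ σ : Fin 2, laminarCoord ν F N (⟨-(k : Fin 3 → ℤ), hk⟩, σ) • basisVec (-(k : Fin 3 → ℤ)) σ) =
          (-(F / (16 * Real.pi ^ 2 * ν) / 2)) • EuclideanSpace.single (0 : Fin 3) (1 : ℝ) := by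
        have hsub : (⟨-(k : Fin 3 → ℤ), hk⟩ : ↥(obliqueReps N)) = ⟨modeE, he⟩ :=
          Subtype.ext (show -(k : Fin 3 → ℤ) = modeE by rw [h2, neg_neg])
        rw [hsub, h2, neg_neg]
        exact sum_laminarCoord_smul_basisVec ν F hN
      rw [this, LinearIsometry.map_smul, smul_comm, neg_smul, neg_neg]
    · rw [if_neg h2]
      by_cases hk : (k : Fin 3 → ℤ) ∈ obliqueReps N
      · rw [obliqueCoeff_apply_of_mem _ hk]
        have : ∀ σ : Fin 2, laminarCoord ν F N (⟨(k : Fin 3 → ℤ), hk⟩, σ) = 0 := fun σ => by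
          simp [laminarCoord, h1]
        simp [this]
      · by_cases hk' : -(k : Fin 3 → ℤ) ∈ obliqueReps N
        · rw [obliqueCoeff_apply_of_neg_mem _ hk']
          have hne : -(k : Fin 3 → ℤ) ≠ modeE := fun h => h2 (by rw [← h, neg_neg])
          have : ∀ σ : Fin 2, laminarCoord ν F N (⟨-(k : Fin 3 → ℤ), hk'⟩, σ) = 0 := fun σ => by
            simp [laminarCoord, hne]
          simp [this]
        · exact obliqueCoeff_apply_of_not_mem _ fun h => (mem_obliqueReps_or_neg_mem h).elim hk hk'

end Summit.AnomalousDissipation.AnomalousDissipation.Theorems.Oblique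

end
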